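import Summits.HubbardSuperconductivity.HubbardSuperconductivity.Theses.ParityGapRigidity
import Literature.MathematicalPhysics.QuantumLattice.HubbardParityGapCeiling
import HarnessLib

/-!
# Route `ParityGapRigidity` — the parity gap of any window is `O(U)`

Crux-facing corollaries of the a-priori parity-gap ceiling
`Literature.MathematicalPhysics.QuantumLattice.uniformParityGap_le` (PG ≤ 4π/L + 4|U|/√(1-δ) along
even `L`, for every sector ground state of `hubbardTorus 2 L 1 U`) for the two undecided items of the
route that speak about the parity gap:

* `gappedWindow_gap_le_coupling` — every `(U, δ, Δ, L₀)` satisfying the parity-gap clause (PG) of the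
  crux `GappedWindow` (stmt-HubbardSuperconductivity-2196; clause verbatim) has `Δ ≤ 2U/√(1-δ)`, and
  `gappedWindow_gap_lt` — hence `Δ < 2√2 · U` on the crux's doping window `δ < 1/2`: the uniform
  one-particle gap of a window is at most linear in its coupling (tightness datum for the crux: a
  window at `U = 1/10` has `Δ < 0.29`; the Kohn–Luttinger candidate has `Δ ~ e^{-c/U²}`);
* `noUniformParityGap_above_ceiling` — the kill criterion `NoUniformParityGap`
  (stmt-HubbardSuperconductivity-2198) HOLDS for every gap above the ceiling: at every `U > 0`,
  `δ ∈ (0, 1/2)` there is no `L`-uniform parity gap `2Δ` with `Δ > 2U/√(1-δ)`.  What remains open of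
  the kill criterion is exactly the band `0 < Δ ≤ 2U/√(1-δ)`.

Sources: as in the Literature file (Tasaki 2020 §2.1, §9.3; Matveev–Larkin 1997). [folklore]
-/

-- the mandated namespace `Summit.<Summit>.<Problem>.Theorems` repeats `HubbardSuperconductivity`
-- (single-problem summit, D-0017), which the `dupNamespace` linter flags on every declaration
set_option linter.dupNamespace false

noncomputable section

namespace Summit.HubbardSuperconductivity.HubbardSuperconductivity.Theorems.ParityGapRigidityCeiling

open Literature.MathematicalPhysics.QuantumLattice

/-- **Every witness of the parity-gap clause of `GappedWindow` has `Δ ≤ 2U/√(1-δ)`.** For `U > 0`,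
`δ ∈ (0, 1/2)`, `Δ` and `L₀` with `2Δ ≤ E(N_L+1) + E(N_L-1) - 2E₀(N_L, S^z=0)` for all even `L ≥ L₀`
(the first conjunct of `Theses.ParityGapRigidity.GappedWindow`, verbatim): `Δ ≤ 2U/√(1-δ)`
(`uniformParityGap_le`). [folklore] -/
theorem gappedWindow_gap_le_coupling (U δ Δ : ℝ) (L₀ : ℕ) (hU : 0 < U) (hδ : δ ∈ Set.Ioo (0 : ℝ) (1 / 2))
    (h : ∀ L ≥ L₀, Even L → ∀ Hm, Hm = Literature.MathematicalPhysics.QuantumLattice.hubbardTorus 2 L 1 U → 2 * Δ ≤ Literature.MathematicalPhysics.QuantumLattice.groundEnergy Hm (2 * ⌊(1 - δ) * (L : ℝ) ^ 2 / 2⌋₊ + 1) + Literature.MathematicalPhysics.QuantumLattice.groundEnergy Hm (2 * ⌊(1 - δ) * (L : ℝ) ^ 2 / 2⌋₊ - 1) - 2 * Matrix.minEnergyOn Hm (Literature.MathematicalPhysics.QuantumLattice.szSector (2 * ⌊(1 - δ) * (L : ℝ) ^ 2 / 2⌋₊) 0)) :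
    Δ ≤ 2 * U / Real.sqrt (1 - δ) := by
  have h1 := uniformParityGap_le U hδ.1.le (by linarith [hδ.2]) h
  rwa [abs_of_pos hU] at h1

/-- **Hence `Δ < 2√2·U` on the crux's doping window** (`√(1-δ) > 1/√2` for `δ < 1/2`). [folklore] -/
theorem gappedWindow_gap_lt (U δ Δ : ℝ) (L₀ : ℕ) (hU : 0 < U) (hδ : δ ∈ Set.Ioo (0 : ℝ) (1 / 2))
    (h : ∀ L ≥ L₀, Even L → ∀ Hm, Hm = Literature.MathematicalPhysics.QuantumLattice.hubbardTorus 2 L 1 U → 2 * Δ ≤ Literature.MathematicalPhysics.QuantumLattice.groundEnergy Hm (2 * ⌊(1 - δ) * (L : ℝ) ^ 2 / 2⌋₊ + 1) + Literature.MathematicalPhysics.QuantumLattice.groundEnergy Hm (2 * ⌊(1 - δ) * (L : ℝ) ^ 2 / 2⌋₊ - 1) - 2 * Matrix.minEnergyOn Hm (Literature.MathematicalPhysics.QuantumLattice.szSector (2 * ⌊(1 - δ) * (L : ℝ) ^ 2 / 2⌋₊) 0)) :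
    Δ < 2 * Real.sqrt 2 * U := by
  have h1 := gappedWindow_gap_le_coupling U δ Δ L₀ hU hδ h
  have hs : Real.sqrt (1 / 2) < Real.sqrt (1 - δ) :=
    Real.sqrt_lt_sqrt (by norm_num) (by linarith [hδ.2])
  have hhalf : Real.sqrt (1 / 2) = 1 / Real.sqrt 2 := by
    rw [Real.sqrt_div' _ (by norm_num : (0:ℝ) ≤ 2), Real.sqrt_one]
  have hs2 : 0 < Real.sqrt 2 := Real.sqrt_pos.2 (by norm_num)
  have hs1 : 0 < Real.sqrt (1 - δ) := Real.sqrt_pos.2 (by linarith [hδ.2])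
  rw [hhalf] at hs
  -- `2U/√(1-δ) < 2U·√2`
  have hlt : 2 * U / Real.sqrt (1 - δ) < 2 * Real.sqrt 2 * U := by
    rw [div_lt_iff₀ hs1]
    have : 1 < Real.sqrt 2 * Real.sqrt (1 - δ) := by
      have h2 := mul_lt_mul_of_pos_left hs hs2
      rwa [mul_one_div_cancel hs2.ne'] at h2
    nlinarith
  exact h1.trans_lt hlt

/-- **The kill criterion holds above the ceiling.** For every `U > 0`, `δ ∈ (0, 1/2)` and every
`Δ > 2U/√(1-δ)` there are NO `L₀` with `2Δ ≤ E(N_L+1) + E(N_L-1) - 2E₀(N_L, S^z=0)` for all even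
`L ≥ L₀`: `Theses.ParityGapRigidity.NoUniformParityGap` restricted to gaps above `2U/√(1-δ)` is a
theorem; its open content is the band `0 < Δ ≤ 2U/√(1-δ)`. [folklore] -/
theorem noUniformParityGap_above_ceiling :
    ∀ (U δ : ℝ), 0 < U → δ ∈ Set.Ioo (0 : ℝ) (1 / 2) → ∀ Δ : ℝ, 2 * U / Real.sqrt (1 - δ) < Δ →
      ¬ ∃ L₀ : ℕ, ∀ L ≥ L₀, Even L → ∀ Hm, Hm = Literature.MathematicalPhysics.QuantumLattice.hubbardTorus 2 L 1 U → 2 * Δ ≤ Literature.MathematicalPhysics.QuantumLattice.groundEnergy Hm (2 * ⌊(1 - δ) * (L : ℝ) ^ 2 / 2⌋₊ + 1) + Literature.MathematicalPhysics.QuantumLattice.groundEnergy Hm (2 * ⌊(1 - δ) * (L : ℝ) ^ 2 / 2⌋₊ - 1) - 2 * Matrix.minEnergyOn Hm (Literature.MathematicalPhysics.QuantumLattice.szSector (2 * ⌊(1 - δ) * (L : ℝ) ^ 2 / 2⌋₊) 0) := by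
  rintro U δ hU hδ Δ hΔ ⟨L₀, h⟩
  have h1 := gappedWindow_gap_le_coupling U δ Δ L₀ hU hδ h
  linarith

end Summit.HubbardSuperconductivity.HubbardSuperconductivity.Theorems.ParityGapRigidityCeiling

end
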